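import Summits.AtomisticToContinuum.HydrodynamicLimit.Theorems.CollisionIsometryCLTAdaptedWeightCLTLine

/-!
# `stub_reduction` of the line `contact-source-duhamel`, helper file 2/6: sup-norm bounds
(crux `CollisionIsometryCLT.AdaptedWeightCLT`, stmt-AtomisticToContinuum-14868 = rev-12 TIME-LOCAL crux; `--supports`)

-- adapted from Theorems/CollisionIsometryCLTAdaptedWeightCLTStubReductionBounds.lean
RE-HOME under `…ContactSourceDuhamel.TimeLocal.Reduction` of the bounds file accepted for the rev-11 item (namespace
`…ContactSourceDuhamel.Reduction`), which imports the rev-11 statements module `…AdaptedWeightCLTStatements.lean`;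
that module no longer elaborates since route rev 12 (`lean check` rc 1: `Iff.rfl` at `adaptedWeightCLT_iff`) and is
append-only, so neither is importable for the rev-12 item. No statement of the line is used here (objects of
`…AdaptedWeightCLTLine` only); the text below is the accepted text verbatim against the new namespace.
Sup-norm bounds on the tensor (pi) types, constants kept opaque (`cT r = #(Fin r → Fin 3)`, `cS r = #(Finset (Fin r))`,
`KT r = cT r (2^r + 1)`): `‖y^{⊗r}‖ ≤ ‖y‖^r`, `|P_{ab}| ≤ 1`, `|Q_{ab}| ≤ 2`, `‖P^{⊗r}T‖ ≤ cT p^r ‖T‖`,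
`|⟨C,T⟩| ≤ cT ‖C‖‖T‖`, `‖Py‖ ≤ ‖y‖`, `‖Qy‖ ≤ 2‖y‖`, `‖crossT‖ ≤ cS M^r`; hence `‖tStep T‖ ≤ KT ‖T‖`,
`‖tTransport_n T‖ ≤ KT^n ‖T‖`, `‖src‖, ‖chaosCross‖, ‖srcCh‖ ≤ cS (4R)^r` for fold velocities and shift bounded by
`R`, `|blkFlow| ≤ Cw cT ‖C‖ (2R)^r`, `‖ubar‖ ≤ R`. Registered anchor: `reduction_norm_projV_le`.
-/


namespace Summit.AtomisticToContinuum.HydrodynamicLimit.Theorems.ContactSourceDuhamel.TimeLocal.Reduction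

open scoped BigOperators Topology Classical MeasureTheory ENNReal InnerProductSpace
open Filter Set MeasureTheory
open Literature.Analysis.FluidPDE
open Literature.MathematicalPhysics.KineticTheory (hsDiameter hsDiameter_le empiricalDensityField
  empiricalMomentumField)

noncomputable section


variable {σ : ℝ} {N : ℕ} {r : ℕ}

/-! ## Opaque combinatorial constants -/

/-- The number of rank-`r` multi-indices (`3^r`, kept opaque). -/
def cT (r : ℕ) : ℝ := Fintype.card (Fin r → Fin 3)

/-- The number of subsets of the slots of a rank-`r` tensor (`2^r`, kept opaque). -/
def cS (r : ℕ) : ℝ := Fintype.card (Finset (Fin r))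

/-- The operator-norm constant of one incoherent transport step: `cT r (2^r + 1)`. -/
def KT (r : ℕ) : ℝ := cT r * (2 ^ r + 1)

/-- `1 ≤ cT r`. -/
theorem one_le_cT (r : ℕ) : 1 ≤ cT r := by
  unfold cT
  exact_mod_cast Fintype.card_pos

/-- `0 ≤ cS r`. -/
theorem cS_nonneg (r : ℕ) : 0 ≤ cS r := by
  unfold cS
  positivity

/-- `1 ≤ KT r`. -/
theorem one_le_KT (r : ℕ) : 1 ≤ KT r := by
  unfold KT
  nlinarith [one_le_cT r, pow_nonneg (zero_le_two (α := ℝ)) r]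

/-! ## Elementary norm bounds -/

/-- A coordinate is bounded by the Euclidean norm. -/
theorem abs_apply_le_norm (y : V3) (a : Fin 3) : |y a| ≤ ‖y‖ := by
  have h := PiLp.norm_apply_le y a
  rwa [Real.norm_eq_abs] at h

/-- `‖y^{⊗r}‖ ≤ ‖y‖^r`. -/
theorem norm_tpow_le (y : V3) : ‖tpow r y‖ ≤ ‖y‖ ^ r := by
  refine (pi_norm_le_iff_of_nonneg (by positivity)).2 fun idx => ?_
  rw [Real.norm_eq_abs, tpow, Finset.abs_prod]
  calc ∏ s, |y (idx s)| ≤ ∏ _s : Fin r, ‖y‖ :=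
        Finset.prod_le_prod (fun _ _ => abs_nonneg _) fun s _ => abs_apply_le_norm y (idx s)
    _ = ‖y‖ ^ r := by simp

/-- The entries of the normal projection are bounded by `1`. -/
theorem abs_projM_le (n : V3) (a b : Fin 3) : |projM n a b| ≤ 1 := by
  unfold projM
  rw [abs_div, abs_mul, abs_of_nonneg (sq_nonneg ‖n‖)]
  by_cases hn : ‖n‖ = 0
  · rw [hn]
    simp
  · rw [div_le_one (by positivity), sq]
    exact mul_le_mul (abs_apply_le_norm n a) (abs_apply_le_norm n b) (abs_nonneg _)
      (norm_nonneg _)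

/-- The entries of the tangential projection are bounded by `2`. -/
theorem abs_coprojM_le (n : V3) (a b : Fin 3) : |coprojM n a b| ≤ 2 := by
  have h1 : |(if a = b then (1 : ℝ) else 0)| ≤ 1 := by split_ifs <;> simp
  have h2 : |n a * n b / ‖n‖ ^ 2| ≤ 1 := abs_projM_le n a b
  unfold coprojM
  calc |(if a = b then (1 : ℝ) else 0) - n a * n b / ‖n‖ ^ 2|
      ≤ |(if a = b then (1 : ℝ) else 0)| + |n a * n b / ‖n‖ ^ 2| := abs_sub _ _
    _ ≤ 1 + 1 := add_le_add h1 h2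
    _ = 2 := by norm_num

/-- `‖P^{⊗r} T‖ ≤ cT r · p^r · ‖T‖` when the entries of `P` are bounded by `p`. -/
theorem norm_mapT_le {P : Mat3} {p : ℝ} (hp0 : 0 ≤ p) (hp : ∀ a b, |P a b| ≤ p) (T : Tens r) :
    ‖mapT P T‖ ≤ cT r * p ^ r * ‖T‖ := by
  refine (pi_norm_le_iff_of_nonneg (by have := one_le_cT r; positivity)).2 fun idx => ?_
  rw [Real.norm_eq_abs]
  unfold mapT
  calc |∑ idx', (∏ s, P (idx s) (idx' s)) * T idx'|
      ≤ ∑ idx', |(∏ s, P (idx s) (idx' s)) * T idx'| := Finset.abs_sum_le_sum_abs _ _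
    _ ≤ ∑ _idx' : Fin r → Fin 3, p ^ r * ‖T‖ := Finset.sum_le_sum fun idx' _ => by
        rw [abs_mul, Finset.abs_prod]
        refine mul_le_mul ?_ ?_ (abs_nonneg _) (by positivity)
        · calc ∏ s, |P (idx s) (idx' s)| ≤ ∏ _s : Fin r, p :=
                Finset.prod_le_prod (fun _ _ => abs_nonneg _) fun s _ => hp _ _
            _ = p ^ r := by simp
        · have h := norm_le_pi_norm T idx'
          rwa [Real.norm_eq_abs] at h
    _ = cT r * p ^ r * ‖T‖ := by
        rw [Finset.sum_const, nsmul_eq_mul, Finset.card_univ, cT]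
        ring

/-- `|⟨C, T⟩| ≤ cT r ‖C‖ ‖T‖`. -/
theorem abs_pairT_le (C T : Tens r) : |pairT C T| ≤ cT r * ‖C‖ * ‖T‖ := by
  unfold pairT
  calc |∑ idx, C idx * T idx| ≤ ∑ idx, |C idx * T idx| := Finset.abs_sum_le_sum_abs _ _
    _ ≤ ∑ _idx : Fin r → Fin 3, ‖C‖ * ‖T‖ := Finset.sum_le_sum fun idx _ => by
        rw [abs_mul]
        have hC := norm_le_pi_norm C idx
        have hT := norm_le_pi_norm T idx
        rw [Real.norm_eq_abs] at hC hT
        exact mul_le_mul hC hT (abs_nonneg _) (norm_nonneg _)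
    _ = cT r * ‖C‖ * ‖T‖ := by
        rw [Finset.sum_const, nsmul_eq_mul, Finset.card_univ, cT]
        ring

/-- `‖P y‖ ≤ ‖y‖` (registered anchor of this helper file). -/
theorem reduction_norm_projV_le : ∀ n y : V3, ‖projV n y‖ ≤ ‖y‖ := by
  intro n y
  unfold projV
  by_cases hn : n = 0
  · simp [hn]
  · have hn' : 0 < ‖n‖ := norm_pos_iff.2 hn
    rw [norm_smul, Real.norm_eq_abs, abs_div, abs_of_nonneg (sq_nonneg ‖n‖), div_mul_eq_mul_div,
      div_le_iff₀ (by positivity)]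
    calc |⟪n, y⟫_ℝ| * ‖n‖ ≤ (‖n‖ * ‖y‖) * ‖n‖ := by
          gcongr
          exact abs_real_inner_le_norm n y
      _ = ‖y‖ * ‖n‖ ^ 2 := by ring

/-- `‖Q y‖ ≤ 2 ‖y‖`. -/
theorem norm_coprojV_le (n y : V3) : ‖coprojV n y‖ ≤ 2 * ‖y‖ := by
  unfold coprojV
  calc ‖y - projV n y‖ ≤ ‖y‖ + ‖projV n y‖ := norm_sub_le _ _
    _ ≤ ‖y‖ + ‖y‖ := add_le_add le_rfl (reduction_norm_projV_le n y)
    _ = 2 * ‖y‖ := by ring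

/-- `‖crossT r a b‖ ≤ cS r · M^r` when `‖a‖, ‖b‖ ≤ M`. -/
theorem norm_crossT_le {qa pb : V3} {M : ℝ} (hM : 0 ≤ M) (ha : ‖qa‖ ≤ M) (hb : ‖pb‖ ≤ M) :
    ‖crossT r qa pb‖ ≤ cS r * M ^ r := by
  refine (pi_norm_le_iff_of_nonneg (by have := cS_nonneg r; positivity)).2 fun idx => ?_
  rw [Real.norm_eq_abs]
  unfold crossT
  calc |∑ S ∈ (Finset.univ : Finset (Finset (Fin r))).filter (fun S => S ≠ ∅ ∧ S ≠ Finset.univ),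
        ∏ s : Fin r, (if s ∈ S then pb (idx s) else qa (idx s))|
      ≤ ∑ S ∈ (Finset.univ : Finset (Finset (Fin r))).filter (fun S => S ≠ ∅ ∧ S ≠ Finset.univ),
        |∏ s : Fin r, (if s ∈ S then pb (idx s) else qa (idx s))| := Finset.abs_sum_le_sum_abs _ _
    _ ≤ ∑ _S ∈ (Finset.univ : Finset (Finset (Fin r))).filter (fun S => S ≠ ∅ ∧ S ≠ Finset.univ),
        M ^ r := Finset.sum_le_sum fun S _ => by
        rw [Finset.abs_prod]
        calc ∏ s, |(if s ∈ S then pb (idx s) else qa (idx s))| ≤ ∏ _s : Fin r, M :=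
              Finset.prod_le_prod (fun _ _ => abs_nonneg _) fun s _ => by
                split_ifs
                · exact (abs_apply_le_norm pb _).trans hb
                · exact (abs_apply_le_norm qa _).trans ha
          _ = M ^ r := by simp
    _ ≤ cS r * M ^ r := by
        rw [Finset.sum_const, nsmul_eq_mul, cS]
        gcongr
        exact_mod_cast Finset.card_le_univ _

/-- A weighted average with nonnegative weights of numbers bounded by `B` is bounded by `B`
(`0/0 = 0`). -/
theorem abs_wavg_le {ι : Type*} (s : Finset ι) (a c : ι → ℝ) {B : ℝ} (hB : 0 ≤ B)
    (ha : ∀ i ∈ s, 0 ≤ a i) (hc : ∀ i ∈ s, |c i| ≤ B) :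
    |(∑ i ∈ s, a i * c i) / ∑ i ∈ s, a i| ≤ B := by
  have hnum : |∑ i ∈ s, a i * c i| ≤ B * ∑ i ∈ s, a i := by
    calc |∑ i ∈ s, a i * c i| ≤ ∑ i ∈ s, |a i * c i| := Finset.abs_sum_le_sum_abs _ _
      _ ≤ ∑ i ∈ s, a i * B := Finset.sum_le_sum fun i hi => by
          rw [abs_mul, abs_of_nonneg (ha i hi)]
          exact mul_le_mul_of_nonneg_left (hc i hi) (ha i hi)
      _ = B * ∑ i ∈ s, a i := by rw [← Finset.sum_mul, mul_comm]
  by_cases h0 : ∑ i ∈ s, a i = 0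
  · rw [h0, div_zero, abs_zero]
    exact hB
  · have hpos : 0 < ∑ i ∈ s, a i := lt_of_le_of_ne (Finset.sum_nonneg ha) (Ne.symm h0)
    rw [abs_div, abs_of_pos hpos, div_le_iff₀ hpos]
    exact hnum

/-- An average of numbers bounded by `B` is bounded by `B`. -/
theorem abs_avg_le (f : Fin (N + 1) → ℝ) {B : ℝ} (hf : ∀ i, |f i| ≤ B) :
    |(((N + 1 : ℕ) : ℝ))⁻¹ * ∑ i, f i| ≤ B := by
  have hN : (0 : ℝ) < ((N + 1 : ℕ) : ℝ) := by positivity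
  rw [abs_mul, abs_inv, abs_of_pos hN, inv_mul_le_iff₀ hN]
  calc |∑ i, f i| ≤ ∑ i, |f i| := Finset.abs_sum_le_sum_abs _ _
    _ ≤ ∑ _i : Fin (N + 1), B := Finset.sum_le_sum fun i _ => hf i
    _ = ((N + 1 : ℕ) : ℝ) * B := by simp

/-- Finite-sum form of the block velocity `ū = m̄/ρ̄` (copy of the dictionary file's `ubar_eq`). -/
theorem ubar_eq' (Φ : Flow σ N) (φ : ℕ → T3 → ℝ) (s : ℝ) (z : Cfg N) (x : T3) :
    ubar σ N Φ φ s z x =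
      ((((N + 1 : ℕ) : ℝ))⁻¹ * ∑ i, φ N ((Φ.flow s z i).1 - x))⁻¹ •
        ((((N + 1 : ℕ) : ℝ))⁻¹ • ∑ i, φ N ((Φ.flow s z i).1 - x) • (Φ.flow s z i).2) := by
  unfold ubar Literature.MathematicalPhysics.KineticTheory.empiricalDensityField
    Literature.MathematicalPhysics.KineticTheory.empiricalMomentumField
  rw [integral_empiricalMeasure, empiricalMeasure_eq, integral_smul_measure,
    integral_finsetSum_measure fun i _ => integrable_dirac (by simp)]
  simp only [integral_dirac, ENNReal.toReal_inv, ENNReal.toReal_natCast]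

/-! ## Bounds on the fold functionals -/

/-- `tTransport m₁ 0 = id`. -/
theorem tTransport_zero (y : Cfg N) (m₁ : ℕ) (T : Fin (N + 1) → Tens r) :
    tTransport r σ N y m₁ 0 T = T := rfl

/-- `tTransport m₁ (n + 1) = tStep (m₁ + n) ∘ tTransport m₁ n`. -/
theorem tTransport_succ' (y : Cfg N) (m₁ n : ℕ) (T : Fin (N + 1) → Tens r) :
    tTransport r σ N y m₁ (n + 1) T = tStep r σ N y (m₁ + n) (tTransport r σ N y m₁ n T) := by
  rw [tTransport, tTransport, List.range'_1_concat, List.foldl_append]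
  rfl

/-- One incoherent transport step is bounded: `‖tStep T‖ ≤ KT r ‖T‖`. -/
theorem norm_tStep_le (y : Cfg N) (k : ℕ) (T : Fin (N + 1) → Tens r) :
    ‖tStep r σ N y k T‖ ≤ KT r * ‖T‖ := by
  have hK1 := one_le_KT r
  have hK0 : 0 ≤ KT r := zero_le_one.trans hK1
  have hcT : 0 ≤ cT r := zero_le_one.trans (one_le_cT r)
  have hmix : ∀ i j, ‖mapT (coprojM (stepNormal σ N y k)) (T i) +
      mapT (projM (stepNormal σ N y k)) (T j)‖ ≤ KT r * ‖T‖ := by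
    intro i j
    calc ‖mapT (coprojM (stepNormal σ N y k)) (T i) + mapT (projM (stepNormal σ N y k)) (T j)‖
        ≤ ‖mapT (coprojM (stepNormal σ N y k)) (T i)‖ +
            ‖mapT (projM (stepNormal σ N y k)) (T j)‖ := norm_add_le _ _
      _ ≤ cT r * 2 ^ r * ‖T i‖ + cT r * 1 ^ r * ‖T j‖ :=
          add_le_add (norm_mapT_le zero_le_two (abs_coprojM_le _) _)
            (norm_mapT_le zero_le_one (abs_projM_le _) _)
      _ ≤ cT r * 2 ^ r * ‖T‖ + cT r * 1 ^ r * ‖T‖ := by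
          gcongr <;> exact norm_le_pi_norm T _
      _ = KT r * ‖T‖ := by rw [KT, one_pow]; ring
  have hid : ∀ i, ‖T i‖ ≤ KT r * ‖T‖ := fun i =>
    (norm_le_pi_norm T i).trans (le_mul_of_one_le_left (norm_nonneg _) hK1)
  rcases h : stepPair σ N y k with _ | ⟨p, q⟩
  · simp only [tStep, h]
    exact le_mul_of_one_le_left (norm_nonneg _) hK1
  · simp only [tStep, h]
    refine (pi_norm_le_iff_of_nonneg (mul_nonneg hK0 (norm_nonneg _))).2 fun i => ?_
    rcases eq_or_ne i q with rfl | hiq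
    · rw [Function.update_self]
      exact hmix _ _
    · rw [Function.update_of_ne hiq]
      rcases eq_or_ne i p with rfl | hip
      · rw [Function.update_self]
        exact hmix _ _
      · rw [Function.update_of_ne hip]
        exact hid i

/-- The incoherent transport through `n` steps is bounded by `KT r ^ n`. -/
theorem norm_tTransport_le (y : Cfg N) (m₁ n : ℕ) (T : Fin (N + 1) → Tens r) :
    ‖tTransport r σ N y m₁ n T‖ ≤ KT r ^ n * ‖T‖ := by
  induction n with
  | zero => rw [tTransport_zero, pow_zero, one_mul]
  | succ n ih =>
    rw [tTransport_succ', pow_succ]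
    calc ‖tStep r σ N y (m₁ + n) (tTransport r σ N y m₁ n T)‖
        ≤ KT r * ‖tTransport r σ N y m₁ n T‖ := norm_tStep_le _ _ _
      _ ≤ KT r * (KT r ^ n * ‖T‖) :=
          mul_le_mul_of_nonneg_left ih (zero_le_one.trans (one_le_KT r))
      _ = KT r ^ n * KT r * ‖T‖ := by ring

/-- The contact source of a step is bounded by `cS r (4R)^r` when the fold velocities of the step
and the shift are bounded by `R`. -/
theorem norm_src_le (y : Cfg N) (u : V3) (l : ℕ) {R : ℝ} (hR : 0 ≤ R)
    (hV : ∀ i, ‖velAfter σ N y l i‖ ≤ R) (hu : ‖u‖ ≤ R) :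
    ‖src r σ N y u l‖ ≤ cS r * (4 * R) ^ r := by
  have hX : ∀ i j, ‖crossT r (coprojV (stepNormal σ N y l) (velAfter σ N y l i - u))
      (projV (stepNormal σ N y l) (velAfter σ N y l j - u))‖ ≤ cS r * (4 * R) ^ r := by
    intro i j
    refine norm_crossT_le (by positivity) ?_ ?_
    · calc ‖coprojV (stepNormal σ N y l) (velAfter σ N y l i - u)‖
          ≤ 2 * ‖velAfter σ N y l i - u‖ := norm_coprojV_le _ _
        _ ≤ 2 * (‖velAfter σ N y l i‖ + ‖u‖) := by gcongr; exact norm_sub_le _ _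
        _ ≤ 4 * R := by linarith [hV i, hu]
    · calc ‖projV (stepNormal σ N y l) (velAfter σ N y l j - u)‖
          ≤ ‖velAfter σ N y l j - u‖ := reduction_norm_projV_le _ _
        _ ≤ ‖velAfter σ N y l j‖ + ‖u‖ := norm_sub_le _ _
        _ ≤ R + R := add_le_add (hV j) hu
        _ ≤ 4 * R := by linarith
  have h0 : (0 : ℝ) ≤ cS r * (4 * R) ^ r := by have := cS_nonneg r; positivity
  rcases h : stepPair σ N y l with _ | ⟨p, q⟩
  · simp only [src, h, norm_zero]
    exact h0
  · simp only [src, h]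
    refine (pi_norm_le_iff_of_nonneg h0).2 fun i => ?_
    rcases eq_or_ne i q with rfl | hiq
    · rw [Function.update_self]
      exact hX _ _
    · rw [Function.update_of_ne hiq]
      rcases eq_or_ne i p with rfl | hip
      · rw [Function.update_self]
        exact hX _ _
      · rw [Function.update_of_ne hip, Pi.zero_apply, norm_zero]
        exact h0

/-- The chaos value of a contact source is bounded by `cS r (4R)^r` (a weighted average with
nonnegative weights of such cross terms). -/
theorem norm_chaosCross_le (w : Fin (N + 1) → ℝ) (W : Vel N) (u n : V3) {R : ℝ} (hR : 0 ≤ R)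
    (hw : ∀ k, 0 ≤ w k) (hW : ∀ k, ‖W k‖ ≤ R) (hu : ‖u‖ ≤ R) :
    ‖chaosCross r N w W u n‖ ≤ cS r * (4 * R) ^ r := by
  have h0 : (0 : ℝ) ≤ cS r * (4 * R) ^ r := by have := cS_nonneg r; positivity
  have hX : ∀ k k', ‖crossT r (coprojV n (W k - u)) (projV n (W k' - u))‖ ≤ cS r * (4 * R) ^ r := by
    intro k k'
    refine norm_crossT_le (by positivity) ?_ ?_
    · calc ‖coprojV n (W k - u)‖ ≤ 2 * ‖W k - u‖ := norm_coprojV_le _ _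
        _ ≤ 2 * (‖W k‖ + ‖u‖) := by gcongr; exact norm_sub_le _ _
        _ ≤ 4 * R := by linarith [hW k, hu]
    · calc ‖projV n (W k' - u)‖ ≤ ‖W k' - u‖ := reduction_norm_projV_le _ _
        _ ≤ ‖W k'‖ + ‖u‖ := norm_sub_le _ _
        _ ≤ R + R := add_le_add (hW k') hu
        _ ≤ 4 * R := by linarith
  refine (pi_norm_le_iff_of_nonneg h0).2 fun idx => ?_
  rw [Real.norm_eq_abs]
  unfold chaosCross
  rw [← Finset.sum_product', ← Finset.sum_product']
  refine abs_wavg_le _ (fun kk : Fin (N + 1) × Fin (N + 1) => w kk.1 * w kk.2 * |⟪W kk.1 - W kk.2, n⟫_ℝ|)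
    (fun kk : Fin (N + 1) × Fin (N + 1) => crossT r (coprojV n (W kk.1 - u)) (projV n (W kk.2 - u)) idx) h0
    (fun kk _ => mul_nonneg (mul_nonneg (hw _) (hw _)) (abs_nonneg _)) (fun kk _ => ?_)
  have h := norm_le_pi_norm (crossT r (coprojV n (W kk.1 - u)) (projV n (W kk.2 - u))) idx
  rw [Real.norm_eq_abs] at h
  exact h.trans (hX _ _)

/-- The chaos-value source of a step is bounded by `cS r (4R)^r`. -/
theorem norm_srcCh_le (y : Cfg N) (w : Fin (N + 1) → ℝ) (u : V3) (l : ℕ) {R : ℝ} (hR : 0 ≤ R)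
    (hw : ∀ k, 0 ≤ w k) (hV : ∀ i, ‖velAfter σ N y l i‖ ≤ R) (hu : ‖u‖ ≤ R) :
    ‖srcCh r σ N y w u l‖ ≤ cS r * (4 * R) ^ r := by
  have h0 : (0 : ℝ) ≤ cS r * (4 * R) ^ r := by have := cS_nonneg r; positivity
  have hX := norm_chaosCross_le (r := r) w (velAfter σ N y l) u (stepNormal σ N y l) hR hw hV hu
  rcases h : stepPair σ N y l with _ | ⟨p, q⟩
  · simp only [srcCh, h, norm_zero]
    exact h0
  · simp only [srcCh, h]
    refine (pi_norm_le_iff_of_nonneg h0).2 fun i => ?_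
    rcases eq_or_ne i q with rfl | hiq
    · rw [Function.update_self]
      exact hX
    · rw [Function.update_of_ne hiq]
      rcases eq_or_ne i p with rfl | hip
      · rw [Function.update_self]
        exact hX
      · rw [Function.update_of_ne hip, Pi.zero_apply, norm_zero]
        exact h0

/-- The flow-side block moment is bounded by `Cw cT ‖C‖ (2R)^r`. -/
theorem abs_blkFlow_le (Φ : Flow σ N) (φ : ℕ → T3 → ℝ) (s : ℝ) (z : Cfg N) (x : T3) (C : Tens r)
    {R Cw : ℝ} (hCw : 0 ≤ Cw) (hw : ∀ i, |wgt σ N Φ φ s z x i| ≤ Cw)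
    (hv : ∀ i, ‖(Φ.flow s z i).2‖ ≤ R) (hu : ‖ubar σ N Φ φ s z x‖ ≤ R) :
    |blkFlow r σ N Φ φ s z x C| ≤ Cw * (cT r * ‖C‖ * (2 * R) ^ r) := by
  have hcT : 0 ≤ cT r := zero_le_one.trans (one_le_cT r)
  unfold blkFlow
  refine abs_avg_le _ fun i => ?_
  rw [abs_mul]
  refine mul_le_mul (hw i) ((abs_pairT_le C _).trans ?_) (abs_nonneg _) hCw
  refine mul_le_mul_of_nonneg_left ((norm_tpow_le _).trans ?_) (by positivity)
  have : ‖(Φ.flow s z i).2 - ubar σ N Φ φ s z x‖ ≤ 2 * R :=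
    (norm_sub_le _ _).trans (by linarith [hv i, hu])
  exact pow_le_pow_left₀ (norm_nonneg _) this r

/-- The block velocity is bounded by the velocity bound: `‖ū‖ ≤ R` (a weighted average of the
velocities with nonnegative weights; `0/0 = 0`). -/
theorem norm_ubar_le (Φ : Flow σ N) (φ : ℕ → T3 → ℝ) (s : ℝ) (z : Cfg N) (x : T3) {R : ℝ}
    (hR : 0 ≤ R) (hφ : ∀ y, 0 ≤ φ N y) (hv : ∀ i, ‖(Φ.flow s z i).2‖ ≤ R) :
    ‖ubar σ N Φ φ s z x‖ ≤ R := by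
  have hN : (0 : ℝ) < ((N + 1 : ℕ) : ℝ) := by positivity
  set a : ℝ := (((N + 1 : ℕ) : ℝ))⁻¹ * ∑ i, φ N ((Φ.flow s z i).1 - x) with ha
  have ha0 : 0 ≤ a := mul_nonneg (inv_nonneg.2 hN.le) (Finset.sum_nonneg fun i _ => hφ _)
  have hm : ‖(((N + 1 : ℕ) : ℝ))⁻¹ • ∑ i, φ N ((Φ.flow s z i).1 - x) • (Φ.flow s z i).2‖ ≤ a * R := by
    rw [norm_smul, Real.norm_eq_abs, abs_inv, abs_of_pos hN, ha, mul_assoc]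
    refine mul_le_mul_of_nonneg_left ?_ (inv_nonneg.2 hN.le)
    calc ‖∑ i, φ N ((Φ.flow s z i).1 - x) • (Φ.flow s z i).2‖
        ≤ ∑ i, ‖φ N ((Φ.flow s z i).1 - x) • (Φ.flow s z i).2‖ := norm_sum_le _ _
      _ ≤ ∑ i, φ N ((Φ.flow s z i).1 - x) * R := Finset.sum_le_sum fun i _ => by
          rw [norm_smul, Real.norm_eq_abs, abs_of_nonneg (hφ _)]
          exact mul_le_mul_of_nonneg_left (hv i) (hφ _)
      _ = (∑ i, φ N ((Φ.flow s z i).1 - x)) * R := by rw [Finset.sum_mul]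
  rw [ubar_eq', norm_smul, Real.norm_eq_abs, ← ha]
  by_cases h0 : a = 0
  · rw [h0, inv_zero, abs_zero, zero_mul]
    exact hR
  · have hpos : 0 < a := lt_of_le_of_ne ha0 (Ne.symm h0)
    rw [abs_inv, abs_of_pos hpos]
    calc a⁻¹ * ‖(((N + 1 : ℕ) : ℝ))⁻¹ • ∑ i, φ N ((Φ.flow s z i).1 - x) • (Φ.flow s z i).2‖
        ≤ a⁻¹ * (a * R) := mul_le_mul_of_nonneg_left hm (inv_nonneg.2 hpos.le)
      _ = R := by field_simp

end

end Summit.AtomisticToContinuum.HydrodynamicLimit.Theorems.ContactSourceDuhamel.TimeLocal.Reduction
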